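import Mathlib.Tactic
import HarnessLib

/-!
# R-W WINDOW-TABLE, unconditional triple socket — the BASE-MULTIPLE and END-LABEL lemmas for the integer cells (pure arithmetic)

PROOF-ONLY file (D-0012; 0 definitions, 0 `Prop` facts; integer arithmetic only) of the abc-iut cell — D-0079 RESCUE sub-cell R-W «WINDOW Θ-SIDE
INEQUALITY», W1 ROW DECISIONS composer seat abc-iut-W-row-1 (gen 2). Companion of `Summits/ABC/IUTFork/Cor312LicenceTripleUnconditional.lean`
(this seat's «W:UNCONDITIONAL-TRIPLE-SOCKET» `WRow.licence_triple_unconditional`), whose arithmetic hypothesis `hcell` asks for the licence socket's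
integer cells `e·⌊(j²P − j·D − (j+1)·ρin)/e⌋ + (j+1)·min(p^A − A·e, p^B − B·e) ≤ P` (`P = e·h₂/l₂`) at EVERY admissible ramification index
`e = e₀·n` and EVERY label `j = i + 1 ≤ l⋆`:
* `WRow.cell_wild_of_base` / `WRow.cell_tame_of_base` — all multiples `n ≥ 1` from the FLOOR-FREE cell at `e₀` with the first envelope member
  (wild shape `D = 2e − 1`, `ρin = e/q`; tame shape `D = e − 1`, `ρin = 1`): the floor-free expression is `n·α + β` with `β ≥ 0`;
* `WRow.quad_nonpos_of_ends` — a convex integer quadratic `≤ 0` at both ends of `[1, L]` is `≤ 0` on `[1, L]`;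
* `WRow.cell_wild_of_ends` / `WRow.cell_tame_of_ends` — hence the cells at every label and every multiple from the TWO floor-free base cells at
  `j = 1` and `j = l⋆`: a rational Frey W-row of the R-W table is two numeric checks per bad prime.
HONEST SCOPE: integer arithmetic only; nothing here bears on the printed inequality; no abc claim. [folklore]
-/

namespace Summit.ABC.IUTFork.Conditional

/-! ## §1. The cells for every multiple of the base index from the floor-free cell at the base -/

/-- **All multiples from the base, wild shape** (`D = 2e − 1`, `ρin = e/q` with `q = p − 1 ∣ e₀`, `P = e·h₂/l₂` with `l₂ ∣ e₀·h₂`): if the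
FLOOR-FREE cell with the first envelope member `p^A − A·e` holds at `e₀` and label `i`, then the socket's exact cell (floor kept, `ρout` the min
of the two members) holds at EVERY `e = e₀·n`, `n ≥ 1` — the floor-free expression is `n·α + β` with `β = (i+1) + (i+2)·p^A ≥ 0`. [folklore] -/
theorem WRow.cell_wild_of_base (p : ℤ) (e₀ q h₂ l₂ A B i : ℕ) (hp : 1 ≤ p) (hq0 : 0 < q) (hq : q ∣ e₀) (hl₂0 : 0 < l₂)
    (hl₂ : l₂ ∣ e₀ * h₂) (he₀ : 0 < e₀)
    (hbase : ((i + 1 : ℕ) : ℤ) ^ 2 * ((e₀ * h₂ / l₂ : ℕ) : ℤ) - ((i + 1 : ℕ) : ℤ) * (2 * (e₀ : ℤ) - 1) -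
        ((i + 2 : ℕ) : ℤ) * ((e₀ / q : ℕ) : ℤ) + ((i + 2 : ℕ) : ℤ) * (p ^ A - (A : ℤ) * (e₀ : ℤ)) ≤ ((e₀ * h₂ / l₂ : ℕ) : ℤ))
    {n : ℕ} (hn : 1 ≤ n) :
    ((e₀ * n : ℕ) : ℤ) * ((((i + 1 : ℕ) : ℤ) ^ 2 * ((e₀ * n * h₂ / l₂ : ℕ) : ℤ) - ((i + 1 : ℕ) : ℤ) * ((2 * (e₀ * n) - 1 : ℕ) : ℤ) -
        ((i + 2 : ℕ) : ℤ) * (((e₀ * n / q : ℕ) : ℤ))) / ((e₀ * n : ℕ) : ℤ)) +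
      ((i + 2 : ℕ) : ℤ) * min (p ^ A - (A : ℤ) * ((e₀ * n : ℕ) : ℤ)) (p ^ B - (B : ℤ) * ((e₀ * n : ℕ) : ℤ)) ≤
      ((e₀ * n * h₂ / l₂ : ℕ) : ℤ) := by
  obtain ⟨k, hk⟩ := hl₂
  obtain ⟨r, hr⟩ := hq
  have hP0 : e₀ * h₂ / l₂ = k := by rw [hk, Nat.mul_div_cancel_left _ hl₂0]
  have hP : e₀ * n * h₂ / l₂ = k * n := by
    rw [show e₀ * n * h₂ = l₂ * (k * n) by rw [mul_right_comm, hk]; ring, Nat.mul_div_cancel_left _ hl₂0]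
  have hR0 : e₀ / q = r := by rw [hr, Nat.mul_div_cancel_left _ hq0]
  have hR : e₀ * n / q = r * n := by rw [hr, mul_assoc, Nat.mul_div_cancel_left _ hq0]
  have he : (0 : ℤ) < ((e₀ * n : ℕ) : ℤ) := by have : 0 < e₀ * n := Nat.mul_pos he₀ (by omega); exact_mod_cast this
  have hsub : ((2 * (e₀ * n) - 1 : ℕ) : ℤ) = 2 * ((e₀ : ℤ) * (n : ℤ)) - 1 := by
    rw [Nat.cast_sub (by nlinarith)]; push_cast; ring
  rw [hP0, hR0] at hbase
  rw [hP, hR, hsub]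
  have hfloor := Int.mul_ediv_self_le (k := ((e₀ * n : ℕ) : ℤ))
    (x := ((i + 1 : ℕ) : ℤ) ^ 2 * ((k * n : ℕ) : ℤ) - ((i + 1 : ℕ) : ℤ) * (2 * ((e₀ : ℤ) * (n : ℤ)) - 1) -
      ((i + 2 : ℕ) : ℤ) * (((r * n : ℕ) : ℤ))) he.ne'
  have hmin : min (p ^ A - (A : ℤ) * ((e₀ * n : ℕ) : ℤ)) (p ^ B - (B : ℤ) * ((e₀ * n : ℕ) : ℤ)) ≤ p ^ A - (A : ℤ) * ((e₀ * n : ℕ) : ℤ) :=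
    min_le_left _ _
  have hJ : (0 : ℤ) ≤ ((i + 2 : ℕ) : ℤ) := by positivity
  have hJm := mul_le_mul_of_nonneg_left hmin hJ
  have hpA : (1 : ℤ) ≤ p ^ A := one_le_pow₀ hp
  -- the coefficient of `n` is `≤ 0` because the constant term is `≥ 0`
  have hα : ((i + 1 : ℕ) : ℤ) ^ 2 * (k : ℤ) - ((i + 1 : ℕ) : ℤ) * (2 * (e₀ : ℤ)) - ((i + 2 : ℕ) : ℤ) * (r : ℤ) -
      ((i + 2 : ℕ) : ℤ) * ((A : ℤ) * (e₀ : ℤ)) - (k : ℤ) ≤ 0 := by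
    have h1 : (0 : ℤ) ≤ ((i + 1 : ℕ) : ℤ) := by positivity
    push_cast at hbase h1 hJ ⊢
    nlinarith
  have hn' : (1 : ℤ) ≤ (n : ℤ) := by exact_mod_cast hn
  have key := mul_nonneg (sub_nonneg.2 hn') (neg_nonneg.2 hα)
  push_cast at hfloor hJm hbase key ⊢
  nlinarith [hfloor, hJm, key, hbase, hpA, hJ]

/-- **All multiples from the base, tame shape** (`D = e − 1`, `ρin = 1`): as `WRow.cell_wild_of_base`, constant term `(i+2)·p^A − 1 ≥ 0`. [folklore] -/
theorem WRow.cell_tame_of_base (p : ℤ) (e₀ h₂ l₂ A B i : ℕ) (hp : 1 ≤ p) (hl₂0 : 0 < l₂) (hl₂ : l₂ ∣ e₀ * h₂) (he₀ : 0 < e₀)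
    (hbase : ((i + 1 : ℕ) : ℤ) ^ 2 * ((e₀ * h₂ / l₂ : ℕ) : ℤ) - ((i + 1 : ℕ) : ℤ) * ((e₀ : ℤ) - 1) -
        ((i + 2 : ℕ) : ℤ) * (1 : ℤ) + ((i + 2 : ℕ) : ℤ) * (p ^ A - (A : ℤ) * (e₀ : ℤ)) ≤ ((e₀ * h₂ / l₂ : ℕ) : ℤ))
    {n : ℕ} (hn : 1 ≤ n) :
    ((e₀ * n : ℕ) : ℤ) * ((((i + 1 : ℕ) : ℤ) ^ 2 * ((e₀ * n * h₂ / l₂ : ℕ) : ℤ) - ((i + 1 : ℕ) : ℤ) * ((e₀ * n - 1 : ℕ) : ℤ) -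
        ((i + 2 : ℕ) : ℤ) * (1 : ℤ)) / ((e₀ * n : ℕ) : ℤ)) +
      ((i + 2 : ℕ) : ℤ) * min (p ^ A - (A : ℤ) * ((e₀ * n : ℕ) : ℤ)) (p ^ B - (B : ℤ) * ((e₀ * n : ℕ) : ℤ)) ≤
      ((e₀ * n * h₂ / l₂ : ℕ) : ℤ) := by
  obtain ⟨k, hk⟩ := hl₂
  have hP0 : e₀ * h₂ / l₂ = k := by rw [hk, Nat.mul_div_cancel_left _ hl₂0]
  have hP : e₀ * n * h₂ / l₂ = k * n := by
    rw [show e₀ * n * h₂ = l₂ * (k * n) by rw [mul_right_comm, hk]; ring, Nat.mul_div_cancel_left _ hl₂0]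
  have he : (0 : ℤ) < ((e₀ * n : ℕ) : ℤ) := by have : 0 < e₀ * n := Nat.mul_pos he₀ (by omega); exact_mod_cast this
  have hsub : ((e₀ * n - 1 : ℕ) : ℤ) = (e₀ : ℤ) * (n : ℤ) - 1 := by
    rw [Nat.cast_sub (by nlinarith)]; push_cast; ring
  rw [hP0] at hbase
  rw [hP, hsub]
  have hfloor := Int.mul_ediv_self_le (k := ((e₀ * n : ℕ) : ℤ))
    (x := ((i + 1 : ℕ) : ℤ) ^ 2 * ((k * n : ℕ) : ℤ) - ((i + 1 : ℕ) : ℤ) * ((e₀ : ℤ) * (n : ℤ) - 1) -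
      ((i + 2 : ℕ) : ℤ) * (1 : ℤ)) he.ne'
  have hmin : min (p ^ A - (A : ℤ) * ((e₀ * n : ℕ) : ℤ)) (p ^ B - (B : ℤ) * ((e₀ * n : ℕ) : ℤ)) ≤ p ^ A - (A : ℤ) * ((e₀ * n : ℕ) : ℤ) :=
    min_le_left _ _
  have hJ : (0 : ℤ) ≤ ((i + 2 : ℕ) : ℤ) := by positivity
  have hJm := mul_le_mul_of_nonneg_left hmin hJ
  have hpA : (1 : ℤ) ≤ p ^ A := one_le_pow₀ hp
  have hα : ((i + 1 : ℕ) : ℤ) ^ 2 * (k : ℤ) - ((i + 1 : ℕ) : ℤ) * (e₀ : ℤ) -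
      ((i + 2 : ℕ) : ℤ) * ((A : ℤ) * (e₀ : ℤ)) - (k : ℤ) ≤ 0 := by
    have h1 : (0 : ℤ) ≤ ((i + 1 : ℕ) : ℤ) := by positivity
    push_cast at hbase h1 hJ ⊢
    nlinarith
  have hn' : (1 : ℤ) ≤ (n : ℤ) := by exact_mod_cast hn
  have key := mul_nonneg (sub_nonneg.2 hn') (neg_nonneg.2 hα)
  push_cast at hfloor hJm hbase key ⊢
  nlinarith [hfloor, hJm, key, hbase, hpA, hJ]

/-- **A convex integer quadratic that is `≤ 0` at both ends of `[1, L]` is `≤ 0` on all of it**: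
`(L−1)·g(J) = (L−J)·g(1) + (J−1)·g(L) − P·(L−1)(J−1)(L−J)`. [folklore] -/
theorem WRow.quad_nonpos_of_ends (P β γ : ℤ) (L : ℕ) (hP : 0 ≤ P)
    (h1 : P * 1 ^ 2 + β * 1 + γ ≤ 0) (hL : P * (L : ℤ) ^ 2 + β * (L : ℤ) + γ ≤ 0)
    (J : ℕ) (hJ1 : 1 ≤ J) (hJL : J ≤ L) : P * (J : ℤ) ^ 2 + β * (J : ℤ) + γ ≤ 0 := by
  by_cases hJ : J = 1
  · subst hJ; simpa using h1
  have hJ1' : (1 : ℤ) ≤ J := by exact_mod_cast hJ1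
  have hJL' : (J : ℤ) ≤ L := by exact_mod_cast hJL
  have hlt : (1 : ℤ) < J := by
    have : 1 < J := lt_of_le_of_ne hJ1 (Ne.symm hJ)
    exact_mod_cast this
  have hL1 : (0 : ℤ) < (L : ℤ) - 1 := by linarith
  have t1 : ((L : ℤ) - J) * (P * 1 ^ 2 + β * 1 + γ) ≤ 0 := mul_nonpos_iff.2 (Or.inl ⟨sub_nonneg.2 hJL', h1⟩)
  have t2 : ((J : ℤ) - 1) * (P * (L : ℤ) ^ 2 + β * (L : ℤ) + γ) ≤ 0 := mul_nonpos_iff.2 (Or.inl ⟨sub_nonneg.2 hJ1', hL⟩)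
  have t3 : 0 ≤ P * ((L : ℤ) - 1) * (((J : ℤ) - 1) * ((L : ℤ) - J)) :=
    mul_nonneg (mul_nonneg hP hL1.le) (mul_nonneg (sub_nonneg.2 hJ1') (sub_nonneg.2 hJL'))
  have key : ((L : ℤ) - 1) * (P * (J : ℤ) ^ 2 + β * (J : ℤ) + γ) ≤ 0 := by nlinarith [t1, t2, t3]
  by_contra hc
  push Not at hc
  have := mul_pos hL1 hc
  linarith

/-- **Wild cells for every admissible index from the TWO END LABELS at the base index**: if the floor-free base cell (`WRow.cell_wild_of_base`)
holds at `i = 0` and at `i = L − 1`, it holds at every `i < L` (convexity in the label: the leading coefficient `P = e₀h₂/l₂ ≥ 0`), hence the exact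
cell holds at every `e = e₀·n`. A rational Frey W-row is thereby TWO numeric checks per bad prime. [folklore] -/
theorem WRow.cell_wild_of_ends (p : ℤ) (e₀ q h₂ l₂ A B L : ℕ) (hp : 1 ≤ p) (hq0 : 0 < q) (hq : q ∣ e₀) (hl₂0 : 0 < l₂)
    (hl₂ : l₂ ∣ e₀ * h₂) (he₀ : 0 < e₀)
    (hends : ∀ i : ℕ, i = 0 ∨ i + 1 = L →
      ((i + 1 : ℕ) : ℤ) ^ 2 * ((e₀ * h₂ / l₂ : ℕ) : ℤ) - ((i + 1 : ℕ) : ℤ) * (2 * (e₀ : ℤ) - 1) -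
        ((i + 2 : ℕ) : ℤ) * ((e₀ / q : ℕ) : ℤ) + ((i + 2 : ℕ) : ℤ) * (p ^ A - (A : ℤ) * (e₀ : ℤ)) ≤ ((e₀ * h₂ / l₂ : ℕ) : ℤ))
    {i : ℕ} (hi : i < L) {n : ℕ} (hn : 1 ≤ n) :
    ((e₀ * n : ℕ) : ℤ) * ((((i + 1 : ℕ) : ℤ) ^ 2 * ((e₀ * n * h₂ / l₂ : ℕ) : ℤ) - ((i + 1 : ℕ) : ℤ) * ((2 * (e₀ * n) - 1 : ℕ) : ℤ) -
        ((i + 2 : ℕ) : ℤ) * (((e₀ * n / q : ℕ) : ℤ))) / ((e₀ * n : ℕ) : ℤ)) +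
      ((i + 2 : ℕ) : ℤ) * min (p ^ A - (A : ℤ) * ((e₀ * n : ℕ) : ℤ)) (p ^ B - (B : ℤ) * ((e₀ * n : ℕ) : ℤ)) ≤
      ((e₀ * n * h₂ / l₂ : ℕ) : ℤ) := by
  refine WRow.cell_wild_of_base p e₀ q h₂ l₂ A B i hp hq0 hq hl₂0 hl₂ he₀ ?_ hn
  have h1 := hends 0 (Or.inl rfl)
  have hL := hends (L - 1) (Or.inr (by omega))
  have hc1 : ((L - 1 + 1 : ℕ) : ℤ) = (L : ℤ) := by rw [Nat.sub_add_cancel (by omega)]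
  have hc2 : ((L - 1 + 2 : ℕ) : ℤ) = (L : ℤ) + 1 := by
    rw [show L - 1 + 2 = L + 1 by omega]; push_cast; ring
  rw [hc1, hc2] at hL
  have q := WRow.quad_nonpos_of_ends ((e₀ * h₂ / l₂ : ℕ) : ℤ)
    (-(2 * (e₀ : ℤ) - 1) - ((e₀ / q : ℕ) : ℤ) + (p ^ A - (A : ℤ) * (e₀ : ℤ)))
    (-((e₀ / q : ℕ) : ℤ) + (p ^ A - (A : ℤ) * (e₀ : ℤ)) - ((e₀ * h₂ / l₂ : ℕ) : ℤ)) L (by positivity)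
    (by push_cast at h1 ⊢; linarith) (by linarith) (i + 1) (by omega) (by omega)
  push_cast at q ⊢
  linarith

/-- **Tame cells for every admissible index from the TWO END LABELS at the base index** (`WRow.cell_tame_of_base` at `i = 0` and `i = L − 1`).
[folklore] -/
theorem WRow.cell_tame_of_ends (p : ℤ) (e₀ h₂ l₂ A B L : ℕ) (hp : 1 ≤ p) (hl₂0 : 0 < l₂) (hl₂ : l₂ ∣ e₀ * h₂) (he₀ : 0 < e₀)
    (hends : ∀ i : ℕ, i = 0 ∨ i + 1 = L →
      ((i + 1 : ℕ) : ℤ) ^ 2 * ((e₀ * h₂ / l₂ : ℕ) : ℤ) - ((i + 1 : ℕ) : ℤ) * ((e₀ : ℤ) - 1) -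
        ((i + 2 : ℕ) : ℤ) * (1 : ℤ) + ((i + 2 : ℕ) : ℤ) * (p ^ A - (A : ℤ) * (e₀ : ℤ)) ≤ ((e₀ * h₂ / l₂ : ℕ) : ℤ))
    {i : ℕ} (hi : i < L) {n : ℕ} (hn : 1 ≤ n) :
    ((e₀ * n : ℕ) : ℤ) * ((((i + 1 : ℕ) : ℤ) ^ 2 * ((e₀ * n * h₂ / l₂ : ℕ) : ℤ) - ((i + 1 : ℕ) : ℤ) * ((e₀ * n - 1 : ℕ) : ℤ) -
        ((i + 2 : ℕ) : ℤ) * (1 : ℤ)) / ((e₀ * n : ℕ) : ℤ)) +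
      ((i + 2 : ℕ) : ℤ) * min (p ^ A - (A : ℤ) * ((e₀ * n : ℕ) : ℤ)) (p ^ B - (B : ℤ) * ((e₀ * n : ℕ) : ℤ)) ≤
      ((e₀ * n * h₂ / l₂ : ℕ) : ℤ) := by
  refine WRow.cell_tame_of_base p e₀ h₂ l₂ A B i hp hl₂0 hl₂ he₀ ?_ hn
  have h1 := hends 0 (Or.inl rfl)
  have hL := hends (L - 1) (Or.inr (by omega))
  have hc1 : ((L - 1 + 1 : ℕ) : ℤ) = (L : ℤ) := by rw [Nat.sub_add_cancel (by omega)]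
  have hc2 : ((L - 1 + 2 : ℕ) : ℤ) = (L : ℤ) + 1 := by
    rw [show L - 1 + 2 = L + 1 by omega]; push_cast; ring
  rw [hc1, hc2] at hL
  have q := WRow.quad_nonpos_of_ends ((e₀ * h₂ / l₂ : ℕ) : ℤ)
    (-((e₀ : ℤ) - 1) - 1 + (p ^ A - (A : ℤ) * (e₀ : ℤ)))
    (-(1 : ℤ) + (p ^ A - (A : ℤ) * (e₀ : ℤ)) - ((e₀ * h₂ / l₂ : ℕ) : ℤ)) L (by positivity)
    (by push_cast at h1 ⊢; linarith) (by linarith) (i + 1) (by omega) (by omega)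
  push_cast at q ⊢
  linarith

end Summit.ABC.IUTFork.Conditional
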